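import Summits.BirchSwinnertonDyer.BirchSwinnertonDyer.Theorems.Rank2ObservatoryRank3PSat5CensusA
import Summits.BirchSwinnertonDyer.BirchSwinnertonDyer.Theorems.Rank2ObservatoryRank3PSat5CensusB
import Summits.BirchSwinnertonDyer.BirchSwinnertonDyer.Theorems.Rank2ObservatoryRank3PSat5CensusC
import Summits.BirchSwinnertonDyer.BirchSwinnertonDyer.Theorems.Rank2ObservatoryRank3SatCensus
import Summits.BirchSwinnertonDyer.BirchSwinnertonDyer.Theorems.Rank2ObservatoryListedSpanP
import HarnessLib

/-!
# BirchSwinnertonDyer — rank ≥ 2 observatory: rank-3 `5`-SATURATION CENSUS, JOIN (index prime to 10)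

HONEST FRAMING: per-curve certified theorems and census instruments; no claim on BSD in rank ≥ 2.

THE `5`-SATURATION CENSUS, COMPLETE (lane `u = 0` = the whole table: no row has `5 ∣ t`; dense
certificates `Rank3PSatCertC`, row Boolean `rank3PSatCheckCL`, 9487 rows): `cover` glues the 27
chunk covers (`PSatCensus5.coverNN`, files II A/B/C); `fiveSaturated_of_mem_rank3Table`: for EVERY
row of the census table the listed span `ℤP₁ + ℤP₂ + ℤP₃ + E(ℚ)_tors` is `5`-saturated in `E(ℚ)`;
the JOIN `index_coprime_ten_of_mem_rows` with the GRAND rank census (`rank_ℤ = 3`, 9365 rows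
certified) and the `2`-census: finite index prime to `10` (`not_dvd_index_listedSpan`), for every
row, no residual. No definitions. Generator: cell
`code/b2b-bsdr2-cert-2/sat2-r3/g35/ks3/gen_census3c.py --p 5`.

References: Cremona, *Algorithms for Modular Elliptic Curves* (1997) §3.5, Tables; Siksek, Rocky
Mountain J. Math. 25 (1995) §3; Silverman, *The Arithmetic of Elliptic Curves* (2009) VIII.6.7.
-/

-- single-conjunct summit: `Summit.BirchSwinnertonDyer.BirchSwinnertonDyer.…` repeats the name
set_option linter.dupNamespace false

namespace Summit.BirchSwinnertonDyer.BirchSwinnertonDyer.Rank2Observatory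

namespace PSatCensus5

open Rank3KernelRankCensusN9365 (rows mem_rank3Table rank_eq_three)

/-- **Coverage of the whole census table** (the 27 chunk covers glued by
`List.forall_mem_append`): for EVERY row the listed span is `5`-saturated.
[cite: CremonaAlgorithms1997, §3.5] -/
theorem cover : ∀ r ∈ rank3Table,
    ∀ h : r.check = true, ∀ a : r.curve.toAffine.Point,
      5 • a ∈ AddSubgroup.closure {r.gen₁ h, r.gen₂ h, r.gen₃ h} ⊔ AddCommGroup.torsion _ →
        a ∈ AddSubgroup.closure {r.gen₁ h, r.gen₂ h, r.gen₃ h} ⊔ AddCommGroup.torsion _ := by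
  unfold rank3Table
  exact
      CensusAudit.forall_app (CensusAudit.forall_app (CensusAudit.forall_app (CensusAudit.forall_app
      (CensusAudit.forall_app (CensusAudit.forall_app (CensusAudit.forall_app
      (CensusAudit.forall_app (CensusAudit.forall_app (CensusAudit.forall_app
      (CensusAudit.forall_app (CensusAudit.forall_app (CensusAudit.forall_app
      (CensusAudit.forall_app (CensusAudit.forall_app (CensusAudit.forall_app
      (CensusAudit.forall_app (CensusAudit.forall_app (CensusAudit.forall_app
      (CensusAudit.forall_app (CensusAudit.forall_app (CensusAudit.forall_app
      (CensusAudit.forall_app (CensusAudit.forall_app (CensusAudit.forall_app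
      (CensusAudit.forall_app cover01 cover02) cover03) cover04) cover05) cover06) cover07) cover08)
      cover09) cover10) cover11) cover12) cover13) cover14) cover15) cover16) cover17) cover18)
      cover19) cover20) cover21) cover22) cover23) cover24) cover25) cover26) cover27

/-- **EVERY row of the census table** (9487 rows, none excepted): the listed span
`ℤP₁ + ℤP₂ + ℤP₃ + E(ℚ)_tors` is `5`-SATURATED in `E(ℚ)`. [cite: CremonaAlgorithms1997, §3.5] -/
theorem fiveSaturated_of_mem_rank3Table {r : Rank3Row} (hr : r ∈ rank3Table)
    (h : r.check = true) :
    ∀ a : r.curve.toAffine.Point,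
      5 • a ∈ AddSubgroup.closure {r.gen₁ h, r.gen₂ h, r.gen₃ h} ⊔ AddCommGroup.torsion _ →
        a ∈ AddSubgroup.closure {r.gen₁ h, r.gen₂ h, r.gen₃ h} ⊔ AddCommGroup.torsion _ :=
  cover r hr h

/-- **THE JOIN with the GRAND rank census and the `2`-census.** For EVERY row of
`Rank2ObservatoryRank3KernelRankCensusN9365.rows` (`rank_ℤ E(ℚ) = 3`), the listed span
`ℤP₁ + ℤP₂ + ℤP₃ + E(ℚ)_tors` has finite index PRIME TO `10` in `E(ℚ)`:
`Reg(P₁, P₂, P₃) = n² · Reg(E(ℚ)/tors)` with `gcd(n, 10) = 1`.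
[cite: CremonaAlgorithms1997, §3.5] [cite: SilvermanAEC2009, Thm. VIII.6.7] -/
theorem index_coprime_ten_of_mem_rows {r : Rank3Row} (hr : r ∈ rows) (h : r.check = true) :
    (AddSubgroup.closure {r.gen₁ h, r.gen₂ h, r.gen₃ h} ⊔ AddCommGroup.torsion _).FiniteIndex ∧
      ¬ 2 ∣ (AddSubgroup.closure {r.gen₁ h, r.gen₂ h, r.gen₃ h} ⊔ AddCommGroup.torsion _).index ∧
      ¬ 5 ∣ (AddSubgroup.closure {r.gen₁ h, r.gen₂ h, r.gen₃ h} ⊔ AddCommGroup.torsion _).index :=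
  by
  obtain ⟨hfi, hodd⟩ := SatCensus.finiteIndex_and_odd_index_of_mem_rows hr h
  haveI := hfi
  exact ⟨hfi, by have := Nat.odd_iff.mp hodd; omega,
    not_dvd_index_listedSpan Nat.prime_five
      (fiveSaturated_of_mem_rank3Table (mem_rank3Table r hr) h)⟩

/-- The same JOIN phrased with the certified rank: for every row of the GRAND census,
`rank_ℤ E(ℚ) = 3` AND the listed span has finite index prime to `10`.
[cite: CremonaAlgorithms1997, §3.5] -/
theorem rank_three_and_index_coprime_ten {r : Rank3Row} (hr : r ∈ rows) (h : r.check = true) :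
    r.curve.mordellWeilRank = 3 ∧
      (AddSubgroup.closure {r.gen₁ h, r.gen₂ h, r.gen₃ h} ⊔ AddCommGroup.torsion _).FiniteIndex ∧
      ¬ 2 ∣ (AddSubgroup.closure {r.gen₁ h, r.gen₂ h, r.gen₃ h} ⊔ AddCommGroup.torsion _).index ∧
      ¬ 5 ∣ (AddSubgroup.closure {r.gen₁ h, r.gen₂ h, r.gen₃ h} ⊔ AddCommGroup.torsion _).index :=
  ⟨rank_eq_three r hr, index_coprime_ten_of_mem_rows hr h⟩

end PSatCensus5

end Summit.BirchSwinnertonDyer.BirchSwinnertonDyer.Rank2Observatory
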